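import Literature.MathematicalPhysics.QuantumFieldTheory.Balaban1983to89.Node00.TkNoExpansionStepZero

/-!
# NODE 00 — THE NO-EXPANSION 𝐓-STEP OF RECORD AT LEVEL k+1: along a new pair with `Ω_{k+1}(s′) = ∅` the objects of record are CONSISTENT by
# unfolding — the `{S_j}`-index, the generations below the top, the determining set, print's class and the background ARE those of `init s′` —
# `𝐓_{k+1}(s′)` is the top generation over the OLD branches, and N11's (S1ᵀ)_k there is an EQUATION BETWEEN TRANSPORTS OF RECORD

Cell `pub-ymgap`, YM-PLAN Track A (HUMAN RULING D-0062); author seat `pub-ymgap-dag-n11-d` (g3; R134 fan-out seat N11 [B14], strategy s2), lineage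
item K1′ `StabilityBAtRecordR12e` = stmt-QuantumFields-19903.  Sequel of `Node00.TkNoExpansionStepZero` (this seat: the level-1 case, the all-large-field
sequence) over def-T's 11a `Node00.TkOfRecord`, 12a `Node00.TkWeightsOfRecord`, FILE 1 `Node00.TStepOfRecord`, 12b `Node00.Record12`, def-R's FILE 16
`Node00.LargeFieldBackgroundMSOfRecord`, r11∕n22-b's `B14Eq218SeqSucc` (`Seq.init`).  [III] = [Balaban1988Convergent], [6] = [Balaban1985RegularSpaces].

WHY.  N11's residue at the Stage-12 record is (S1ᵀ) «`SLaw₁₂ θ P k → TLaw₁₂ θ P k`, `k < K`» ([III] Theorem p. 245 at the objects of record).  Among the new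
sequences `s′` of length `k+1` over a given `init s′`, the one with `Ω_{k+1}(s′) = ∅` (no new small-field region; `Λ_{k+1}(s′) = ∅`) is where print performs NO
expansion ((2.22): the top generation `𝐓^{(k)}` has no A-integral) and where [III]'s Theorem p. 245 is BOOKKEEPING: «old factors agree».  This file checks, IN
KERNEL, the part of that bookkeeping the tree's objects of record must and do satisfy BY CONSTRUCTION — the index set, the lower generations, the (2.2)
determining set, the (2.12) class and def-R's chosen background do not change along such a step — unfolds `𝐓_{k+1}(s′)` there into the top generation acting
on the OLD branch operators `𝐓_k(init s′, S)`, and writes the (S1ᵀ)_k clause at `s′` as an explicit equation between def-T's one-step transports of record,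
with only the two operands `A_k(init s′)` (from `ρ_k`'s §2 form) and `A_{k+1}(s′)` (from the (S1ᵀ)_k witness) left symbolic — the level-(k+1) twin of file 1's
coherence equation.  What print PROVES there (that the witness can be taken with the old terms and no new ones, so that the two sides agree) is NOT asserted.

WHAT THIS FILE PROVES (0 `sorry`, 0 `instance`, 0 `notation`; 2 `def`s = named readings; `N`-generic).
§1 SEQUENCES.  `seq_init_Ω_of_le`∕`seq_init_Λ_of_le` (`init` keeps `Ω_j, Λ_j`, `j ≤ k`, incl. `j = 0`); **`admSSeq_succ_eq_init_of_Omega_empty`** ∕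
   `admSOfRecord_succ_eq_init_of_Omega_empty`: at `Ω_{k+1}(s′) = ∅` the finite `{S_j}`-index ((2.1)) of `s′` EQUALS that of `init s′` (`S_{k+1} ⊆ Ω_{k+1} = ∅`);
   `apply_succ_eq_empty_of_mem_admSOfRecord`.
§2 GENERIC 11a.  `genDataOfRecord_congr_seq` (generation data read the sequence only through `(Ω_{j+1}, Λ_{j+1})`), `genDataOfRecord_eq_init` (`j+1 ≤ k`),
   `genDataOfRecord_top_eq_of_apply_empty`; `Tk.pairCfgAt k V′ U` (two-scale configuration at scales `(k, k+1)`; `pairCfgAt_zero : pairCfgAt 0 = pairCfg`),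
   `noExpIntegrandAt K k W Ψ` (`ζ_k(T)·w_k(∅,∅,∅)·Ψ` at it; `noExpIntegrand_eq_noExpIntegrandAt`); **`tkBranchOfRecord_eq_init`** (`𝐓_i(s′,S) = 𝐓_i(init s′,S)`,
   `i ≤ k`); **`TkOfRecord_succ_eq_sum_genOp_of_Omega_empty`** (`𝐓_{k+1}(s′)Φ = Σ_{S ∈ admS_k(init s′)} 𝐓^{(k)}[𝐓_k(init s′,S)Φ_S]`, (3.24));
   **`TkOfRecord_succ_eq_sum_kernelRT_of_Omega_empty`** (POINTWISE: the sum over the old index of restricted kernel transports on the FULL bond sets of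
   `noExpIntegrandAt k W (𝐓_k(init s′,S)Φ_S)`); `TkOfRecord_succ_ae_eq_sum_transportOfRecord_of_Omega_empty` (the a.e. face as a SUM of def-T transports,
   `k < K`, displayed joint measurability + bound per old branch).
§3 BACKGROUNDS.  **`genSet_succ_eq_init_of_Omega_empty`** ((2.2) for `k ≥ 1`: `𝐁({Ω_j}_{j≤k+1}) = 𝐁({Ω_j}_{j≤k})` — `Γ_k = Ω_k∖∅`, `Γ_{k+1} = ∅`),
   `omegaPlaqs_init_of_le`, `regMSOfRecord_succ_eq_init_of_Omega_empty` ([6] (1.7): the extra clause reads no plaquette), **`UbgMSOfRecord_succ_eq_init_of_Omega_empty`**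
   ∕ `UbgOfRecord₁₂_succ_eq_init_of_Omega_empty` (def-R's classical-choice background and 12b's map UNCHANGED as functions of the retained configuration, `k ≥ 1`),
   `UbgOfRecord₁₂_one_eq_init_of_Omega_empty` (`k = 0`: on print's class, file 1's `UbgOfRecord₁₂_one_of_Omega_empty` against the level-0 pin `𝐖 ↦ 𝐖 0`).
§4 MEASURE THEORY.  **`transportK_congr_ae_family`** ∕ `transportK_congr_ae` (generic gauge group, measurable averaging with `HaarAC`): integrand families equal
   for `dU`-a.e. `U` at every `V` have `dV`-a.e. equal one-step transports (disintegration `(h·dV) ⊗ κ = jointLaw`: the exceptional fine set is `κ_V`-null for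
   a.e. `V` with `h(V) ≠ 0`; NO measurability of the integrands needed) — complements file 1's `transportK_congr_ae_of_fibre`.
§5 AT THE STAGE-12 RECORD.  `slotsTOfRecord_succ_apply` (def-T's (†) unfolded); **`slotsTOfRecord_succ_of_sLaw₁₂`** (under `SLaw₁₂ θ p k`, `k < K`: the pre-𝐑 slot
   `slotT_{k+1}(s′)` is `≡ 0` — absent old slot, transport of the zero integrand — or `=ᵐ transportOfRecord k [w(s′)·χ_k(init)·𝐓_k(init)e^{A_k(init)}]`);
   `sect2Slot_succ_eq_sum_kernelRT_of_Omega_empty` ∕ `…_ae_eq_sum_transport_…`; `tLaw₁₂_clause_of_Omega_empty` (the (S1ᵀ)_k clause at a no-expansion `s′`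
   guard-free: `χ_{k+1}(s′) ≡ 1`); **`tLaw₁₂_coherence_of_Omega_empty`** (THE LEVEL-(k+1) COHERENCE EQUATION: `slotT_{k+1}(s′) ≡ 0 ∨ transportOfRecord k
   [w(s′)·χ_k(init s′)·𝐓_k(init s′)e^{A_k(init s′)}] =ᵐ Σ_S transportOfRecord k [ζ0_k(T)·χreg_k(T)·e^{−½quad_k(∅)}·𝐓_k(init s′,S)e^{A_{k+1}(s′)}_S]`).

HONEST SCOPE.  Kernel bookkeeping on the tree's OWN objects; every identity is PROVED by unfolding; the two measure-theoretic faces from displayed hypotheses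
(`k < K`, joint measurability and a bound — def-T's `TStepProvisos` style; the residual readings are not measurable by construction).  Nothing of Bałaban's is
asserted: Theorem p. 245, Thm 2 [III], (3.6)–(3.25) are what would make the coherence equation TRUE at a correct witness (old terms kept, no new terms at a
no-expansion step).  N11 is NOT discharged; no node count moves (typed 28∕28 · discharged 5∕28).  One finite four-torus programme at fixed `ε = L^{−K}`, Bałaban
AS PRINTED with locators; NOT ℝ⁴, NOT infinite volume, NOT OS, NOT a mass gap, NOT the Clay problem.  Sources: [III] (2.1)–(2.2) pp. 254–255, (2.10)–(2.13)
pp. 256–257, (2.17)–(2.18) p. 257, (2.20)–(2.23) p. 258, Thm 1 p. 262, (3.1) p. 264, (3.24)–(3.25) p. 270, Theorem p. 245; [6] (1.7) p. 77;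
[Balaban1985Averaging] (10) p. 19.
-/

noncomputable section

open MeasureTheory
open scoped Matrix.Norms.L2Operator

namespace Literature.MathematicalPhysics.QuantumFieldTheory.Balaban1983to89.Node00

open T4AveragingDisintegration T4Continuum T4FiniteEpsInhabited Tk B14.Eq218Concrete

/-! ## §1  Sequences: `init` below the top index; the `{S_j}`-index at a no-expansion top pair -/

section Sequences

variable {α : Type*} {D : ℕ → Set (Set α)} {k : ℕ}

/-- `init` keeps `Ω_j` for every `j ≤ k` (also `j = 0`, where both are `∅` off the window). [cite: Balaban1988Convergent, (2.1) p.254 (bookkeeping)] -/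
theorem seq_init_Ω_of_le (s : Seq D (k + 1)) {j : ℕ} (hj : j ≤ k) : s.init.Ω j = s.Ω j := by
  by_cases h1 : 1 ≤ j
  · exact Seq.init_Ω s h1 hj
  · rw [s.init.Ω_off j (fun h => h1 h.1), s.Ω_off j (fun h => h1 h.1)]

/-- `init` keeps `Λ_j` for every `j ≤ k`. [cite: Balaban1988Convergent, (2.1) p.254 (bookkeeping)] -/
theorem seq_init_Λ_of_le (s : Seq D (k + 1)) {j : ℕ} (hj : j ≤ k) : s.init.Λ j = s.Λ j := by
  by_cases h1 : 1 ≤ j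
  · exact Seq.init_Λ s h1 hj
  · rw [s.init.Λ_off j (fun h => h1 h.1), s.Λ_off j (fun h => h1 h.1)]

/-- **THE `{S_j}`-INDEX AT A NO-EXPANSION TOP PAIR IS THE OLD INDEX**: if `Ω_{k+1}(s′) = ∅` then an admissible `{S_j}`-sequence for `s′` ((2.1): `S_j ⊂ Ω_j ∩ Λ_jᶜ`,
unions of cubes, `∅` off the window) has `S_{k+1} = ∅` and is exactly an admissible sequence for `init s′` — the finite index sets COINCIDE.
[cite: Balaban1988Convergent, (2.1) p.254, (2.18) p.257] -/
theorem admSSeq_succ_eq_init_of_Omega_empty [Finite α] (C : ℕ → Set (Set α)) (hC : ∀ j, (∅ : Set α) ∈ C j) (s : Seq D (k + 1))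
    (hΩ : s.Ω (k + 1) = ∅) : admSSeq C (k + 1) s = admSSeq C k s.init := by
  ext S
  rw [mem_admSSeq_iff, mem_admSSeq_iff]
  constructor
  · rintro ⟨hwin, hoff⟩
    have hk1 : S (k + 1) = ∅ := by
      have h := (hwin (k + 1) (Nat.succ_pos k) le_rfl).2
      rw [hΩ, Set.empty_inter] at h
      exact Set.subset_empty_iff.mp h
    refine ⟨fun j h1 hj => ?_, fun j hj => ?_⟩
    · rw [seq_init_Ω_of_le s hj, seq_init_Λ_of_le s hj]
      exact hwin j h1 (Nat.le_succ_of_le hj)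
    · by_cases hjk : j = k + 1
      · rw [hjk, hk1]
      · exact hoff j (fun h => hj ⟨h.1, by omega⟩)
  · rintro ⟨hwin, hoff⟩
    refine ⟨fun j h1 hj => ?_, fun j hj => hoff j (fun h => hj ⟨h.1, Nat.le_succ_of_le h.2⟩)⟩
    by_cases hjk : j = k + 1
    · subst hjk
      rw [hoff (k + 1) (fun h => absurd h.2 (by omega))]
      exact ⟨hC _, Set.empty_subset _⟩
    · have hj' : j ≤ k := by omega
      rw [← seq_init_Ω_of_le s hj', ← seq_init_Λ_of_le s hj']
      exact hwin j h1 hj'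

end Sequences

section OfRecordIndex

variable (F : T4Family) {ν : Stage7Numerics} {M : ℕ} {g : ℕ → ℝ} {K k : ℕ}

/-- … of record: `admSOfRecord (k+1) s′ = admSOfRecord k (init s′)` at `Ω_{k+1}(s′) = ∅`. [cite: Balaban1988Convergent, (2.1) p.254, (2.18) p.257] -/
theorem admSOfRecord_succ_eq_init_of_Omega_empty (s : SeqOfRecord F ν M g K (k + 1)) (hΩ : s.Ω (k + 1) = ∅) :
    admSOfRecord F ν M g K (k + 1) s = admSOfRecord F ν M g K k s.init :=
  admSSeq_succ_eq_init_of_Omega_empty _ (empty_mem_SClassOfRecord F ν g K) s hΩ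

/-- A member of the old index is `∅` at the new top scale (off its window). [cite: Balaban1988Convergent, (2.1) p.254 (bookkeeping)] -/
theorem apply_succ_eq_empty_of_mem_admSOfRecord {s : SeqOfRecord F ν M g K k} {S : ℕ → Set (Site (F.P K) 0)}
    (hS : S ∈ admSOfRecord F ν M g K k s) : S (k + 1) = ∅ :=
  ((mem_admSSeq_iff _ s S).1 hS).2 (k + 1) (fun h => absurd h.2 (by omega))

end OfRecordIndex

/-! ## §2  Generic 11a: the generations below the top agree with `init`; `𝐓_{k+1}(s′)` at `Ω_{k+1}(s′) = ∅` unfolded -/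

section GenDataCongr

variable {F : T4Family} {N : ℕ} [NeZero N] {V : Type}
variable (ν : Stage7Numerics) (M : ℕ) (g : ℕ → ℝ) (K : ℕ) (W : TkWeights F N V K)

/-- The generation-`j` data of record read the sequence ONLY through the pair `(Ω_{j+1}, Λ_{j+1})` (and the branch through `S_{j+1}`): two sequences of any
lengths with the same pair have the same data. [cite: Balaban1988Convergent, (2.21) p.258 (bookkeeping)] -/
theorem genDataOfRecord_congr_seq {n n' : ℕ} (s : SeqOfRecord F ν M g K n) (s' : SeqOfRecord F ν M g K n') (S : ℕ → Set (Site (F.P K) 0)) (j : ℕ)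
    (hΩ : s.Ω (j + 1) = s'.Ω (j + 1)) (hΛ : s.Λ (j + 1) = s'.Λ (j + 1)) {hdec : DecidableEq (PBond (F.P K) j)} :
    genDataOfRecord F N V ν M g K W s S j = genDataOfRecord F N V ν M g K W s' S j := by
  have key : ∀ {n : ℕ} (t : SeqOfRecord F ν M g K n) (A B : Set (Site (F.P K) 0)), t.Ω (j + 1) = A → t.Λ (j + 1) = B →
      genDataOfRecord F N V ν M g K W t S j =
        { sV := (Set.toFinite (B10Eq42TorusConstraint.bondsIn j Aᶜ)).toFinset
          sV' := (Set.toFinite (B10Eq42TorusConstraint.bondsIn (j + 1) Aᶜ)).toFinset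
          vT := kernelRTOfRecord F N K j _ _
          ζ := W.ζ j Aᶜ
          sA := (Set.toFinite (B10Eq42TorusConstraint.bondsIn j (Bᶜ ∩ A))).toFinset
          w := W.w j B (Bᶜ ∩ A) (S (j + 1)) } := by
    rintro n t A B rfl rfl
    rfl
  exact (key s _ _ hΩ hΛ).trans (key s' _ _ rfl rfl).symm

/-- **THE GENERATIONS BELOW THE TOP READ ONLY `init s′`**: for `j + 1 ≤ k` the generation-`j` data of record of `s′` (bond sets from `Ω_{j+1}`, A-bonds and
A-weight from `Λ_{j+1}`, `Ω_{j+1}`, `S_{j+1}`) ARE those of `init s′`. [cite: Balaban1988Convergent, (2.20)–(2.21) p.258] -/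
theorem genDataOfRecord_eq_init {k : ℕ} (s : SeqOfRecord F ν M g K (k + 1)) (S : ℕ → Set (Site (F.P K) 0)) (j : ℕ) (hj : j + 1 ≤ k)
    {hdec : DecidableEq (PBond (F.P K) j)} :
    genDataOfRecord F N V ν M g K W s S j = genDataOfRecord F N V ν M g K W s.init S j :=
  genDataOfRecord_congr_seq ν M g K W s s.init S j (seq_init_Ω_of_le s hj).symm (seq_init_Λ_of_le s hj).symm

/-- At a member of the old index the top generation's data do not depend on the member (its A-weight reads `S_{k+1} = ∅`).
[cite: Balaban1988Convergent, (2.21) p.258 (bookkeeping)] -/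
theorem genDataOfRecord_top_eq_of_apply_empty {k : ℕ} (s : SeqOfRecord F ν M g K (k + 1)) {S : ℕ → Set (Site (F.P K) 0)}
    (hS : S (k + 1) = ∅) {hdec : DecidableEq (PBond (F.P K) k)} :
    genDataOfRecord F N V ν M g K W s S k = genDataOfRecord F N V ν M g K W s (fun _ => ∅) k := by
  unfold genDataOfRecord
  rw [hS]

end GenDataCongr

section TwoScale

variable (F : T4Family) (N : ℕ) (V : Type) [NormedAddCommGroup V]

/-- **THE TWO-SCALE CONFIGURATION AT SCALES `(k, k+1)`**: `(V_k, V_{k+1}) := (U, V′)`, zero fluctuation variables, the base configuration of `V′` elsewhere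
(11a's `baseCfg (k+1) V′` updated at scale `k`); at `k = 0` it is `Tk.pairCfg` (`pairCfgAt_zero`). [cite: Balaban1988Convergent, (2.21) p.258, (2.18) p.257] -/
def Tk.pairCfgAt {P : Params} {G V : Type} [One G] [Zero V] (k : ℕ) (V' : GaugeField P (k + 1) G) (U : GaugeField P k G) : MultiCfg P G V :=
  Function.update (baseCfg (k + 1) V') k (U, 0)

/-- Scale `k` of the two-scale configuration is `(U, 0)`. [cite: Balaban1988Convergent, (2.21) p.258 (bookkeeping)] -/
@[simp] theorem Tk.pairCfgAt_self {P : Params} {G V : Type} [One G] [Zero V] (k : ℕ) (V' : GaugeField P (k + 1) G) (U : GaugeField P k G) :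
    pairCfgAt (V := V) k V' U k = (U, 0) :=
  Function.update_self _ _ _

/-- Off scale `k` it is the base configuration of `V′`. [cite: Balaban1988Convergent, (2.18) p.257 (bookkeeping)] -/
theorem Tk.pairCfgAt_of_ne {P : Params} {G V : Type} [One G] [Zero V] (k : ℕ) (V' : GaugeField P (k + 1) G) (U : GaugeField P k G) {j : ℕ}
    (hj : j ≠ k) : pairCfgAt (V := V) k V' U j = baseCfg (k + 1) V' j :=
  Function.update_of_ne hj _ _

/-- Scale `k+1` reads `V′`. [cite: Balaban1988Convergent, (2.18) p.257 (bookkeeping)] -/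
@[simp] theorem Tk.pairCfgAt_succ_fst {P : Params} {G V : Type} [One G] [Zero V] (k : ℕ) (V' : GaugeField P (k + 1) G) (U : GaugeField P k G) :
    (pairCfgAt (V := V) k V' U (k + 1)).1 = V' := by
  funext b
  rw [pairCfgAt_of_ne k V' U (Nat.succ_ne_self k)]
  exact baseCfg_fst_self (V := V) (k + 1) V' b

/-- The fluctuation variables vanish at every scale. [cite: Balaban1988Convergent, (2.21) p.258 (bookkeeping)] -/
@[simp] theorem Tk.pairCfgAt_snd {P : Params} {G V : Type} [One G] [Zero V] (k : ℕ) (V' : GaugeField P (k + 1) G) (U : GaugeField P k G) (j : ℕ) :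
    (pairCfgAt (V := V) k V' U j).2 = 0 := by
  by_cases hj : j = k
  · subst hj; rw [pairCfgAt_self]
  · rw [pairCfgAt_of_ne k V' U hj, baseCfg_snd]

/-- At `k = 0` the two-scale configuration is `Tk.pairCfg` of `TkNoExpansionStepZero` (`rfl`). [cite: Balaban1988Convergent, (2.21) p.258 (bookkeeping)] -/
theorem Tk.pairCfgAt_zero {P : Params} {G V : Type} [One G] [Zero V] (V1 : GaugeField P 1 G) (U : GaugeField P 0 G) :
    pairCfgAt (V := V) 0 V1 U = pairCfg V1 U := rfl

/-- **THE NO-EXPANSION INTEGRAND OF THE TOP GENERATION `𝐓^{(k)}`** for the weight datum `W` and an old-branch function `Ψ` (in (2.20): `Ψ = 𝐓_k(init s′, S)Φ_S`):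
`ζ_k(T)·w_k(∅,∅,∅)·Ψ` read at the two-scale configuration `(U, V′)`. [cite: Balaban1988Convergent, (2.21)–(2.22) p.258, (3.24) p.270] -/
def noExpIntegrandAt (K k : ℕ) (W : TkWeights F N V K) (Ψ : MultiCfg (F.P K) (SU N) V → ℝ) (V' : GaugeField (F.P K) (k + 1) (SU N))
    (U : GaugeField (F.P K) k (SU N)) : ℝ :=
  W.ζ k Set.univ (pairCfgAt k V' U) * (W.w k ∅ ∅ ∅ (pairCfgAt k V' U) * Ψ (pairCfgAt k V' U))

/-- At `k = 0` and `Ψ =` the operand at the empty branch it is `noExpIntegrand` of `TkNoExpansionStepZero` (`rfl`). [cite: Balaban1988Convergent, (2.21)–(2.22) p.258 (bookkeeping)] -/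
theorem noExpIntegrand_eq_noExpIntegrandAt {K : ℕ} (W0 : TkWeights F N V K) (Φ : SFluct (F.P K) V → B15DeterminingSets.MSField (F.P K) (SU N) → ℝ)
    (V1 : GaugeField (F.P K) 1 (SU N)) (U : GaugeField (F.P K) 0 (SU N)) :
    noExpIntegrand F N V K W0 Φ V1 U = noExpIntegrandAt F N V K 0 W0 (fun ω => Φ (fun _ => ∅, fun j => (ω j).2) (fun j => (ω j).1)) V1 U := rfl

end TwoScale

section Generic

variable {F : T4Family} {N : ℕ} [NeZero N] {V : Type} [NormedAddCommGroup V] [InnerProductSpace ℝ V] [FiniteDimensional ℝ V]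
  [MeasurableSpace V] [BorelSpace V]
variable (ν : Stage7Numerics) (M : ℕ) (g : ℕ → ℝ) (K : ℕ) (W : TkWeights F N V K)


/-- **`𝐓_i(s′, S) = 𝐓_i(init s′, S)` for `i ≤ k`** (the ordered product (2.20) of the generations `j < i`, each reading only `init s′`).
[cite: Balaban1988Convergent, (2.20) p.258, (3.24) p.270] -/
theorem tkBranchOfRecord_eq_init {k : ℕ} (s : SeqOfRecord F ν M g K (k + 1)) (S : ℕ → Set (Site (F.P K) 0)) :
    ∀ (i : ℕ), i ≤ k → ∀ (Φ : MultiCfg (F.P K) (SU N) V → ℝ),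
      tkBranchOfRecord F N V ν M g K W s S i Φ = tkBranchOfRecord F N V ν M g K W s.init S i Φ
  | 0, _, _ => rfl
  | i + 1, hi, Φ => by
      rw [tkBranchOfRecord_succ, tkBranchOfRecord_succ, tkBranchOfRecord_eq_init s S i (Nat.le_of_succ_le hi) Φ,
        genDataOfRecord_eq_init ν M g K W s S i hi]

/-- **`𝐓_{k+1}(s′)` AT A NO-EXPANSION TOP PAIR** (`Ω_{k+1}(s′) = ∅`): the sum over the OLD index of the top generation applied to the old branch operators
`𝐓_k(init s′, S)` of the operand — `𝐓_{k+1} = 𝐓^{(k)} 𝐓_k` ((3.24)) with `𝐓_k` that of `init s′`. [cite: Balaban1988Convergent, (2.18) p.257, (2.20)–(2.22) p.258, (3.24) p.270] -/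
theorem TkOfRecord_succ_eq_sum_genOp_of_Omega_empty {k : ℕ} (s : SeqOfRecord F ν M g K (k + 1)) (hΩ : s.Ω (k + 1) = ∅)
    (Φ : SFluct (F.P K) V → B15DeterminingSets.MSField (F.P K) (SU N) → ℝ) (V' : GaugeField (F.P K) (k + 1) (SU N))
    {hdec : DecidableEq (PBond (F.P K) k)} :
    TkOfRecord F N V ν M g K W (k + 1) s Φ V' =
      ∑ S ∈ admSOfRecord F ν M g K k s.init,
        genOp k (genDataOfRecord F N V ν M g K W s (fun _ => ∅) k)
          (tkBranchOfRecord F N V ν M g K W s.init S k (fun ω => Φ (S, fun j => (ω j).2) (fun j => (ω j).1))) (baseCfg (k + 1) V') := by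
  obtain rfl : hdec = fun a b => Classical.propDecidable (a = b) := Subsingleton.elim _ _
  rw [TkOfRecord_apply, admSOfRecord_succ_eq_init_of_Omega_empty F s hΩ]
  refine Finset.sum_congr rfl fun S hS => ?_
  rw [tkBranchOfRecord_succ, tkBranchOfRecord_eq_init ν M g K W s S k le_rfl,
    genDataOfRecord_top_eq_of_apply_empty ν M g K W s (apply_succ_eq_empty_of_mem_admSOfRecord F hS)]

/-- **THE NO-EXPANSION 𝐓-SLOT AT LEVEL k+1, UNFOLDED**: at `Ω_{k+1}(s′) = ∅`, `(𝐓_{k+1}(s′)Φ)(V′)` is the SUM over the old index of 11a's restricted kernel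
transports of record ON THE FULL BOND SETS of `ζ_k(T)·w_k(∅,∅,∅)·[𝐓_k(init s′, S)Φ_S]` at the configuration `(V_k, V_{k+1}) = (1 updated by y, V′)` (other
scales at the base), read at `V′|sV′` — one δ-constrained `V_k`-integration, no A-integral ((2.22)). [cite: Balaban1988Convergent, (2.21)–(2.22) p.258, (3.24) p.270] -/
theorem TkOfRecord_succ_eq_sum_kernelRT_of_Omega_empty {k : ℕ} (s : SeqOfRecord F ν M g K (k + 1)) (hΩ : s.Ω (k + 1) = ∅)
    (Φ : SFluct (F.P K) V → B15DeterminingSets.MSField (F.P K) (SU N) → ℝ) (V' : GaugeField (F.P K) (k + 1) (SU N))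
    {hdec : DecidableEq (PBond (F.P K) k)} :
    TkOfRecord F N V ν M g K W (k + 1) s Φ V' =
      ∑ S ∈ admSOfRecord F ν M g K k s.init,
        kernelRTOfRecord F N K k (genDataOfRecord F N V ν M g K W s (fun _ => ∅) k).sV (genDataOfRecord F N V ν M g K W s (fun _ => ∅) k).sV'
          (fun y => noExpIntegrandAt F N V K k W
            (tkBranchOfRecord F N V ν M g K W s.init S k (fun ω => Φ (S, fun j => (ω j).2) (fun j => (ω j).1))) V'
            (Function.updateFinset (fun _ => 1) (genDataOfRecord F N V ν M g K W s (fun _ => ∅) k).sV y))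
          (fun b => V' b) := by
  have hΛ : s.Λ (k + 1) = ∅ := seq_Λ_eq_empty_of_Ω_eq_empty s hΩ
  have hk : k ≠ k + 1 := by omega
  rw [TkOfRecord_succ_eq_sum_genOp_of_Omega_empty ν M g K W s hΩ Φ V' (hdec := hdec)]
  refine Finset.sum_congr rfl fun S _ => ?_
  rw [genOp_genDataOfRecord_of_Omega_empty V ν M g K W s (fun _ => ∅) k (hdec := hdec) hΩ]
  congr 1
  · funext y
    rw [baseCfg_fst_of_ne (V := V) hk, baseCfg_snd, hΩ, hΛ, Set.compl_empty, Set.inter_empty]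
    rfl
  · funext b
    exact baseCfg_fst_self (V := V) (k + 1) V' b

/-- **THE A.E. FACE OF THE LEVEL-(k+1) NO-EXPANSION SLOT**: for `k < K` and old-branch integrand families that are JOINTLY MEASURABLE AND BOUNDED (displayed,
per member of the old index), `𝐓_{k+1}(s′)Φ` IS the SUM over the old index of def-T's one-step transports of record of the no-expansion integrands, for
`dV′`-a.e. `V′` (the full-bond-set face on each summand; finitely many a.e. statements). [cite: Balaban1988Convergent, (2.21)–(2.22) p.258, (3.1) p.264, (3.24)–(3.25) p.270] -/
theorem TkOfRecord_succ_ae_eq_sum_transportOfRecord_of_Omega_empty {k : ℕ} (hk : k < K) (s : SeqOfRecord F ν M g K (k + 1)) (hΩ : s.Ω (k + 1) = ∅)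
    (Φ : SFluct (F.P K) V → B15DeterminingSets.MSField (F.P K) (SU N) → ℝ) {C : ℝ}
    (hm : ∀ S ∈ admSOfRecord F ν M g K k s.init, Measurable (Function.uncurry (noExpIntegrandAt F N V K k W
      (tkBranchOfRecord F N V ν M g K W s.init S k (fun ω => Φ (S, fun j => (ω j).2) (fun j => (ω j).1))))))
    (hC : ∀ S ∈ admSOfRecord F ν M g K k s.init, ∀ V' U, |noExpIntegrandAt F N V K k W
      (tkBranchOfRecord F N V ν M g K W s.init S k (fun ω => Φ (S, fun j => (ω j).2) (fun j => (ω j).1))) V' U| ≤ C) :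
    TkOfRecord F N V ν M g K W (k + 1) s Φ =ᵐ[fieldMeasure (F.P K) (k + 1) (SU N)]
      fun V' => ∑ S ∈ admSOfRecord F ν M g K k s.init, transportOfRecord F N K k (noExpIntegrandAt F N V K k W
        (tkBranchOfRecord F N V ν M g K W s.init S k (fun ω => Φ (S, fun j => (ω j).2) (fun j => (ω j).1))) V') V' := by
  classical
  set D := genDataOfRecord F N V ν M g K W s (fun _ => ∅) k with hD
  have hV : ∀ b, b ∈ D.sV := mem_sV_of_Omega_empty V ν M g K W s (fun _ => ∅) k hΩ
  have hV' : ∀ b, b ∈ D.sV' := mem_sV'_of_Omega_empty V ν M g K W s (fun _ => ∅) k hΩ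
  have hface : ∀ S ∈ admSOfRecord F ν M g K k s.init,
      (fun V' : GaugeField (F.P K) (k + 1) (SU N) => kernelRTOfRecord F N K k D.sV D.sV'
        (fun y => noExpIntegrandAt F N V K k W
          (tkBranchOfRecord F N V ν M g K W s.init S k (fun ω => Φ (S, fun j => (ω j).2) (fun j => (ω j).1))) V'
          (Function.updateFinset (fun _ => 1) D.sV y)) (fun b => V' b)) =ᵐ[fieldMeasure (F.P K) (k + 1) (SU N)]
      fun V' => transportOfRecord F N K k (noExpIntegrandAt F N V K k W
        (tkBranchOfRecord F N V ν M g K W s.init S k (fun ω => Φ (S, fun j => (ω j).2) (fun j => (ω j).1))) V') V' := by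
    intro S hS
    have hmf : Measurable (Function.uncurry fun (V' : GaugeField (F.P K) (k + 1) (SU N)) (y : ↥D.sV → SU N) =>
        noExpIntegrandAt F N V K k W
          (tkBranchOfRecord F N V ν M g K W s.init S k (fun ω => Φ (S, fun j => (ω j).2) (fun j => (ω j).1))) V'
          (Function.updateFinset (fun _ => 1) D.sV y)) :=
      (hm S hS).comp (measurable_fst.prodMk (measurable_updateFinset.comp measurable_snd))
    have h := kernelRTOfRecord_full_ae_eq_transportOfRecord F N K k hk (hdec := inferInstance) D.sV hV D.sV' hV' _ hmf
      (fun V' y => hC S hS V' _)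
    filter_upwards [h] with V' h1
    rw [h1]
    simp only [updateFinset_one_restrict_of_forall_mem hV]
  have hall := (Filter.eventually_all_finset (admSOfRecord F ν M g K k s.init)).2 hface
  filter_upwards [hall] with V' hV'S
  rw [TkOfRecord_succ_eq_sum_kernelRT_of_Omega_empty ν M g K W s hΩ Φ V']
  exact Finset.sum_congr rfl fun S hS => hV'S S hS

end Generic


/-! ## §3  The determining set, print's class and the background of record are UNCHANGED along a no-expansion step (`k ≥ 1`; at `k = 0` on the class) -/

section Backgrounds

open B15DeterminingSets

variable {P : Params} {D : ℕ → Set (Set (Site P 0))} {k : ℕ}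

/-- **(2.2) ALONG A NO-EXPANSION STEP**: for `k ≥ 1` and `Ω_{k+1}(s′) = ∅` the determining set of `s′` IS that of `init s′` — `Γ₀ = Ω₁ᶜ`, `Γ_j = Ω_j∖Ω_{j+1}`
(`j < k`), `Γ_k = Ω_k∖Ω_{k+1} = Ω_k`, `Γ_{k+1} = Ω_{k+1} = ∅`. [cite: Balaban1988Convergent, (2.2) p.255] -/
theorem genSet_succ_eq_init_of_Omega_empty (hk : 1 ≤ k) (s : Seq D (k + 1)) (hΩ : s.Ω (k + 1) = ∅) : genSet s.Ω (k + 1) = genSet s.init.Ω k := by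
  funext i
  unfold genSet
  congr 1
  unfold gammaRegion
  rcases Nat.lt_trichotomy i k with hi | rfl | hi
  · by_cases hi0 : i = 0
    · subst hi0
      rw [if_neg (by omega), if_neg (by omega), if_pos rfl, if_neg (by omega), if_neg (by omega), if_pos rfl, seq_init_Ω_of_le s hk]
    · rw [if_neg (by omega), if_neg (by omega), if_neg hi0, if_neg (by omega), if_neg (by omega), if_neg hi0,
        seq_init_Ω_of_le s (le_of_lt hi), seq_init_Ω_of_le s (Nat.succ_le_of_lt hi)]
  · rw [if_neg (by omega), if_neg (by omega), if_neg (by omega), if_neg (lt_irrefl _), if_pos rfl, hΩ, Set.sdiff_empty,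
      seq_init_Ω_of_le s le_rfl]
  · by_cases hik : i = k + 1
    · subst hik
      rw [if_neg (lt_irrefl _), if_pos rfl, hΩ, if_pos hi]
    · rw [if_pos (by omega), if_pos hi]

variable {F : T4Family} {N : ℕ} [NeZero N] {ν : Stage7Numerics} {M : ℕ} {g : ℕ → ℝ} {K : ℕ}

/-- The plaquette sets «p ∈ Ω_j» of `init s′` are those of `s′` for `j ≤ k`. [cite: Balaban1985RegularSpaces, (1.7) p.77 (bookkeeping)] -/
theorem omegaPlaqs_init_of_le (s : SeqOfRecord F ν M g K (k + 1)) {j : ℕ} (hj : j ≤ k) : omegaPlaqs s.init.Ω j = omegaPlaqs s.Ω j := by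
  simp only [omegaPlaqs, seq_init_Ω_of_le s hj]

variable (N) in
/-- **PRINT'S CLASS `U_{k+1}({Ω_j}, ε₀)` ALONG A NO-EXPANSION STEP IS `U_k`'s**: the extra clause reads the plaquettes meeting `Ω_{k+1} = ∅` — none.
[cite: Balaban1985RegularSpaces, (1.7) p.77; Balaban1988Convergent, (2.12) p.256] -/
theorem regMSOfRecord_succ_eq_init_of_Omega_empty (s : SeqOfRecord F ν M g K (k + 1)) (hΩ : s.Ω (k + 1) = ∅) :
    regMSOfRecord F N ν K (k + 1) s.Ω = regMSOfRecord F N ν K k s.init.Ω := by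
  ext U
  rw [mem_regMSOfRecord_iff, mem_regMSOfRecord_iff]
  constructor
  · intro h j hj
    rw [omegaPlaqs_init_of_le s hj]
    exact h j (Nat.le_succ_of_le hj)
  · intro h j hj
    by_cases hjk : j = k + 1
    · subst hjk
      rw [omegaPlaqs_succ, hΩ]
      intro q hq
      rcases hq with hq | hq | hq | hq <;> exact absurd hq (Set.notMem_empty _)
    · have hj' : j ≤ k := by omega
      rw [← omegaPlaqs_init_of_le s hj']
      exact h j hj'

variable (N) in
/-- **def-R's MULTI-SCALE BACKGROUND OF RECORD IS UNCHANGED ALONG A NO-EXPANSION STEP** (`k ≥ 1`): same averaging, same determining set, same class ⇒ the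
same (2.12) solution map — `U_{k+1}(s′) = U_k(init s′)` as maps of the retained configuration (print: no new small-field region, no new minimisation).
[cite: Balaban1988Convergent, (2.12)–(2.13) pp.256–257, Thm 1 p.262] -/
theorem UbgMSOfRecord_succ_eq_init_of_Omega_empty (hk : 1 ≤ k) (s : SeqOfRecord F ν M g K (k + 1)) (hΩ : s.Ω (k + 1) = ∅) :
    UbgMSOfRecord F N ν M g K (k + 1) s = UbgMSOfRecord F N ν M g K k s.init := by
  funext W
  rw [UbgMSOfRecord_apply, UbgMSOfRecord_apply, regMSOfRecord_succ_eq_init_of_Omega_empty N s hΩ, genSet_succ_eq_init_of_Omega_empty hk s hΩ]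

variable (θ : Stage12Params F N) (p : B12.RunParams)

/-- **12b's BACKGROUND MAP OF RECORD IS UNCHANGED ALONG A NO-EXPANSION STEP, `k ≥ 1`**: `UbgOfRecord₁₂ θ p (k+1) s′ = UbgOfRecord₁₂ θ p k (init s′)`.
[cite: Balaban1988Convergent, (2.12)–(2.13) pp.256–257] -/
theorem UbgOfRecord₁₂_succ_eq_init_of_Omega_empty {k : ℕ} (hk : 1 ≤ k)
    (s : SeqOfRecord F θ.ν θ.τ9.M (gOfRecord₁₀ F N θ.toStage9Params p) p.K (k + 1)) (hΩ : s.Ω (k + 1) = ∅) :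
    UbgOfRecord₁₂ F N θ p (k + 1) s = UbgOfRecord₁₂ F N θ p k s.init := by
  obtain ⟨k', rfl⟩ : ∃ k', k = k' + 1 := ⟨k - 1, by omega⟩
  rw [UbgOfRecord₁₂_succ, UbgOfRecord₁₂_succ]
  exact UbgMSOfRecord_succ_eq_init_of_Omega_empty N hk s hΩ

/-- **… AND AT `k = 0` ON PRINT'S CLASS** (the level-`0` pin `𝐖 ↦ 𝐖 0` of 12b against the level-`1` minimiser, this seat's `UbgOfRecord₁₂_one_of_Omega_empty`):
`U_1(s′)(𝐖) = U_0(init s′)(𝐖) = 𝐖 0` for `ε₀`-regular `𝐖 0`. [cite: Balaban1988Convergent, Thm 1 p.262, (2.12) p.256] -/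
theorem UbgOfRecord₁₂_one_eq_init_of_Omega_empty (s : SeqOfRecord F θ.ν θ.τ9.M (gOfRecord₁₀ F N θ.toStage9Params p) p.K 1) (hΩ : s.Ω 1 = ∅)
    (W : MSField (F.P p.K) (SU N)) (hW : PlaqSmall (θ.ν.εreg * (F.P p.K).eta 0 ^ 2) (W 0)) :
    UbgOfRecord₁₂ F N θ p 1 s W = UbgOfRecord₁₂ F N θ p 0 s.init W := by
  rw [UbgOfRecord₁₂_one_of_Omega_empty θ p s hΩ W hW]
  rfl

end Backgrounds

/-! ## §4  Measure theory: the transport respects a.e.-equal integrand families; the a.e. face of the level-(k+1) no-expansion slot -/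

section TransportCongrAE

open ProbabilityTheory

variable {P : Params} {j : ℕ} {G : Type*} [GaugeGroup G] [MeasurableSpace G] [HaarData G] [StandardBorelSpace G]

/-- **THE ONE-STEP KERNEL TRANSPORT RESPECTS `dU`-A.E. EQUALITY OF INTEGRAND FAMILIES**: if for `dU`-almost every fine field `U` the families agree at
EVERY coarse field (`f V U = g V U`), then `transportK avg (f V) V = transportK avg (g V) V` for `dV`-a.e. `V` — the exceptional fine set is `κ_V`-null for
a.e. `V` with positive marginal density (disintegration `(h·dV) ⊗ κ = jointLaw`).  No measurability of `f`, `g` needed. [cite: Balaban1988Convergent, (3.1) p.264; Balaban1985Averaging, (10) p.19] -/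
theorem transportK_congr_ae_family {avg : GaugeField P j G → GaugeField P (j + 1) G} (havg : Measurable avg) (hac : HaarAC avg)
    {f g : GaugeField P (j + 1) G → GaugeField P j G → ℝ} (hfg : ∀ᵐ U ∂fieldMeasure P j G, ∀ V, f V U = g V U) :
    (fun V => transportK avg (f V) V) =ᵐ[fieldMeasure P (j + 1) G] fun V => transportK avg (g V) V := by
  have h0 : fieldMeasure P j G {U | ¬ ∀ V, f V U = g V U} = 0 := ae_iff.1 hfg
  obtain ⟨N', hsub, hN'm, hN'0⟩ := exists_measurable_superset_of_null h0
  have hdis := disintegration_fieldMeasure (P := P) (G := G) havg hac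
  have h1 : (((fieldMeasure P (j + 1) G).withDensity fun V => (avgDensity avg V : ENNReal)) ⊗ₘ avgKernel avg)
      (Prod.snd ⁻¹' N') = 0 := by
    rw [hdis, jointLaw, Measure.map_apply (measurable_graphMap havg) (measurable_snd hN'm)]
    exact hN'0
  rw [Measure.compProd_apply (measurable_snd hN'm)] at h1
  have hpre : ∀ V : GaugeField P (j + 1) G, Prod.mk V ⁻¹' (Prod.snd ⁻¹' N' : Set (GaugeField P (j + 1) G × GaugeField P j G)) = N' :=
    fun V => rfl
  simp only [hpre] at h1
  have h2 : ∀ᵐ V ∂((fieldMeasure P (j + 1) G).withDensity fun V => (avgDensity avg V : ENNReal)), avgKernel avg V N' = 0 := by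
    have h3 := (lintegral_eq_zero_iff (Kernel.measurable_coe (avgKernel avg) hN'm)).1 h1
    filter_upwards [h3] with V hV
    exact hV
  rw [ae_withDensity_iff measurable_margDensity.coe_nnreal_ennreal] at h2
  filter_upwards [h2] with V hV
  show kernelTransport _ _ avg (f V) V = kernelTransport _ _ avg (g V) V
  unfold kernelTransport
  by_cases hz : margDensity (fieldMeasure P j G) (fieldMeasure P (j + 1) G) avg V = 0
  · simp only [hz, NNReal.coe_zero, zero_mul]
  · have hN : avgKernel avg V N' = 0 := hV (by exact_mod_cast hz)
    have hae : ∀ᵐ U ∂(avgKernel avg V), f V U = g V U := by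
      have hnull : avgKernel avg V {U | ¬ f V U = g V U} = 0 :=
        measure_mono_null (fun U hU => hsub fun hall => hU (hall V)) hN
      exact ae_iff.2 hnull
    show (margDensity _ _ avg V : ℝ) * ∫ U, f V U ∂(avgKernel avg V) = (margDensity _ _ avg V : ℝ) * ∫ U, g V U ∂(avgKernel avg V)
    rw [integral_congr_ae hae]

/-- … in particular for `V`-independent integrands: `f =ᵐ g` ⇒ `transportK avg f =ᵐ transportK avg g`. [cite: Balaban1988Convergent, (3.1) p.264] -/
theorem transportK_congr_ae {avg : GaugeField P j G → GaugeField P (j + 1) G} (havg : Measurable avg) (hac : HaarAC avg)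
    {f g : GaugeField P j G → ℝ} (hfg : f =ᵐ[fieldMeasure P j G] g) :
    transportK avg f =ᵐ[fieldMeasure P (j + 1) G] transportK avg g :=
  transportK_congr_ae_family (f := fun _ => f) (g := fun _ => g) havg hac (hfg.mono fun _ hU _ => hU)

end TransportCongrAE


/-! ## §5  At the Stage-12 record: the pre-𝐑 slot at level k+1 under `SLaw₁₂ θ p k`, the §2-form slot at a no-expansion `s′`, (S1ᵀ)_k there as a
transport equation -/

section AtRecord

variable {F : T4Family} {N : ℕ} [NeZero N]

/-- **THE PRE-𝐑 SLOT OF RECORD AT LEVEL k+1, UNFOLDED** (def-T's (†)): for EVERY new sequence `s′`,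
`slotT_{k+1}(s′)(V′) = ∫dU δ(ŪV′⁻¹) [w(s′)(U,V′)·χ_k(init s′)(U)·slot_k(init s′)(U)]`. [cite: Balaban1988Convergent, (3.1) p.264, (3.24)–(3.25) p.270] -/
theorem slotsTOfRecord_succ_apply (ν : Stage7Numerics) (τ : TowerNumerics) (E : B12.RunParams → ℝ) (w : StepWeightsOfRecord F N ν τ.M)
    (ppSel : PpSelOfRecord F ν τ.M) (p : B12.RunParams) (g : ℕ → ℝ) (k : ℕ) (s : SeqOfRecord F ν τ.M g p.K (k + 1))
    (V' : GaugeField (F.P p.K) (k + 1) (SU N)) :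
    slotsTOfRecord F N ν τ E w ppSel p g (k + 1) s V' =
      transportOfRecord F N p.K k (fun U => w p g k s U V' *
        (chiSeqOfRecord F N ν τ.M g p.K k s.init U * slotsOfRecord F N ν τ E w ppSel p g k s.init U)) V' := by
  rw [slotsTOfRecord_succ, tstepOfRecord_apply]

variable (θ : Stage12Params F N) (p : B12.RunParams)

/-- **UNDER `SLaw₁₂ θ p k` THE PRE-𝐑 SLOT AT LEVEL k+1 IS THE TRANSPORT OF `w(s′)·χ_k·𝐓_k(init s′)e^{A_k(init s′)}`** (or the zero function): the §2 dichotomy at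
`init s′` — slot absent (then `slotT_{k+1}(s′) ≡ 0` POINTWISE: the transport of the zero integrand), or the (2.18) identity a.e. on the `χ_k`-support (then the
integrand families agree for `dU`-a.e. `U` at every `V′`, and the transport respects that: `transportK_congr_ae_family`, `k < K`).
[cite: Balaban1988Convergent, (2.18) p.257, Thm 1 p.262, (3.1) p.264, (3.25) p.270] -/
theorem slotsTOfRecord_succ_of_sLaw₁₂ {k : ℕ} (hk : k < p.K) (hS : SLaw₁₂ F N θ p k)
    (s : SeqOfRecord F θ.ν θ.τ9.M (gOfRecord₁₀ F N θ.toStage9Params p) p.K (k + 1)) :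
    ∃ (t : SeqOfRecord F θ.ν θ.τ9.M (gOfRecord₁₀ F N θ.toStage9Params p) p.K k → Sect2.TermValues (F.P p.K) (MatA N) (FluctV N) θ.τ9.M)
      (Ek : SeqOfRecord F θ.ν θ.τ9.M (gOfRecord₁₀ F N θ.toStage9Params p) p.K k → ℝ),
      Sect2.UniversalE t ∧
      (∀ s₀, Sect2.LawsRT (sect2TowerOfRecord F N (FluctV N) p.K (settingOfRecord₁₂ F N θ p) (θ.Rz p.K) s₀ (t s₀)) (settingOfRecord₁₂ F N θ p).lf k) ∧
      (slotsTOfRecord F N θ.ν θ.τ9 (EOfRecord₁₀ F N θ.toStage9Params) (wOfRecord₉ F N θ.toStage9Params) θ.ppSel p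
          (gOfRecord₁₀ F N θ.toStage9Params p) (k + 1) s = 0 ∨
        slotsTOfRecord F N θ.ν θ.τ9 (EOfRecord₁₀ F N θ.toStage9Params) (wOfRecord₉ F N θ.toStage9Params) θ.ppSel p
            (gOfRecord₁₀ F N θ.toStage9Params p) (k + 1) s =ᵐ[fieldMeasure (F.P p.K) (k + 1) (SU N)]
          fun V' => transportOfRecord F N p.K k (fun U =>
            wOfRecord₉ F N θ.toStage9Params p (gOfRecord₁₀ F N θ.toStage9Params p) k s U V' *
              (chiSeqOfRecord F N θ.ν θ.τ9.M (gOfRecord₁₀ F N θ.toStage9Params p) p.K k s.init U *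
                sect2Slot F N (FluctV N) p.K (settingOfRecord₁₂ F N θ p) (θ.Rz p.K) (WtOfRecord₁₂ F N θ p) s.init (t s.init) (Ek s.init)
                  (UbgOfRecord₁₂ F N θ p k s.init) U)) V') := by
  obtain ⟨t, Ek, hu, hs⟩ := (sLaw₁₂_iff F N θ p k).mp hS
  refine ⟨t, Ek, hu, fun s₀ => (hs s₀).1, ?_⟩
  rcases (hs s.init).2 with h0 | hid
  · refine Or.inl ?_
    funext V'
    rw [slotsTOfRecord_succ_apply, h0]
    show transportOfRecord F N p.K k (fun U => _ * (_ * (0 : ℝ))) V' = 0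
    simp only [mul_zero]
    show kernelTransport _ _ _ (fun _ => (0 : ℝ)) V' = 0
    simp only [kernelTransport, integral_zero, mul_zero]
  · refine Or.inr ?_
    have h := transportK_congr_ae_family (avOfRecord_measurable F N p.K k) (avOfRecord_haarAC F N p.K k hk)
      (f := fun V' U => wOfRecord₉ F N θ.toStage9Params p (gOfRecord₁₀ F N θ.toStage9Params p) k s U V' *
        (chiSeqOfRecord F N θ.ν θ.τ9.M (gOfRecord₁₀ F N θ.toStage9Params p) p.K k s.init U *
          slotsOfRecord F N θ.ν θ.τ9 (EOfRecord₁₀ F N θ.toStage9Params) (wOfRecord₉ F N θ.toStage9Params) θ.ppSel p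
            (gOfRecord₁₀ F N θ.toStage9Params p) k s.init U))
      (g := fun V' U => wOfRecord₉ F N θ.toStage9Params p (gOfRecord₁₀ F N θ.toStage9Params p) k s U V' *
        (chiSeqOfRecord F N θ.ν θ.τ9.M (gOfRecord₁₀ F N θ.toStage9Params p) p.K k s.init U *
          sect2Slot F N (FluctV N) p.K (settingOfRecord₁₂ F N θ p) (θ.Rz p.K) (WtOfRecord₁₂ F N θ p) s.init (t s.init) (Ek s.init)
            (UbgOfRecord₁₂ F N θ p k s.init) U))
      (hid.mono fun U hU V' => by
        by_cases hχ : chiSeqOfRecord F N θ.ν θ.τ9.M (gOfRecord₁₀ F N θ.toStage9Params p) p.K k s.init U = 0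
        · simp only [hχ, zero_mul, mul_zero]
        · rw [hU hχ])
    filter_upwards [h] with V' hV'
    rw [slotsTOfRecord_succ_apply]
    exact hV'

/-- **THE §2-FORM SLOT `𝐓_{k+1}(s′) exp A_{k+1}(s′)` OF RECORD AT A NO-EXPANSION `s′`, UNFOLDED POINTWISE**: the sum over the old index of restricted kernel
transports on the full bond sets of the no-expansion integrands of the old branches of the §2 operand. [cite: Balaban1988Convergent, (2.18) p.257, (2.21)–(2.23) p.258, (3.24) p.270] -/
theorem sect2Slot_succ_eq_sum_kernelRT_of_Omega_empty {k : ℕ}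
    (s : SeqOfRecord F θ.ν θ.τ9.M (gOfRecord₁₀ F N θ.toStage9Params p) p.K (k + 1)) (hΩ : s.Ω (k + 1) = ∅)
    (t : Sect2.TermValues (F.P p.K) (MatA N) (FluctV N) θ.τ9.M) (Ek : ℝ) (U : BgMap F N p.K) (V' : GaugeField (F.P p.K) (k + 1) (SU N))
    {hdec : DecidableEq (PBond (F.P p.K) k)} :
    sect2Slot F N (FluctV N) p.K (settingOfRecord₁₂ F N θ p) (θ.Rz p.K) (WtOfRecord₁₂ F N θ p) s t Ek U V' =
      ∑ S ∈ admSOfRecord F θ.ν θ.τ9.M (gOfRecord₁₀ F N θ.toStage9Params p) p.K k s.init,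
        kernelRTOfRecord F N p.K k (genDataOfRecord F N (FluctV N) θ.ν θ.τ9.M _ p.K (WtOfRecord₁₂ F N θ p) s (fun _ => ∅) k).sV
          (genDataOfRecord F N (FluctV N) θ.ν θ.τ9.M _ p.K (WtOfRecord₁₂ F N θ p) s (fun _ => ∅) k).sV'
          (fun y => noExpIntegrandAt F N (FluctV N) p.K k (WtOfRecord₁₂ F N θ p)
            (tkBranchOfRecord F N (FluctV N) θ.ν θ.τ9.M _ p.K (WtOfRecord₁₂ F N θ p) s.init S k
              (fun ω => sect2Operand F N (FluctV N) p.K (settingOfRecord₁₂ F N θ p) (θ.Rz p.K) s t Ek U (S, fun j => (ω j).2) (fun j => (ω j).1)))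
            V' (Function.updateFinset (fun _ => 1) (genDataOfRecord F N (FluctV N) θ.ν θ.τ9.M _ p.K (WtOfRecord₁₂ F N θ p) s (fun _ => ∅) k).sV y))
          (fun b => V' b) :=
  TkOfRecord_succ_eq_sum_kernelRT_of_Omega_empty θ.ν θ.τ9.M _ p.K (WtOfRecord₁₂ F N θ p) s hΩ _ V'

/-- **… AND ALMOST EVERYWHERE AS A SUM OF def-T's TRANSPORTS OF RECORD** (`k < K`; displayed joint measurability + bound per old branch).
[cite: Balaban1988Convergent, (2.18) p.257, (3.1) p.264, (3.25) p.270] -/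
theorem sect2Slot_succ_ae_eq_sum_transport_of_Omega_empty {k : ℕ} (hk : k < p.K)
    (s : SeqOfRecord F θ.ν θ.τ9.M (gOfRecord₁₀ F N θ.toStage9Params p) p.K (k + 1)) (hΩ : s.Ω (k + 1) = ∅)
    (t : Sect2.TermValues (F.P p.K) (MatA N) (FluctV N) θ.τ9.M) (Ek : ℝ) (U : BgMap F N p.K) {C : ℝ}
    (hm : ∀ S ∈ admSOfRecord F θ.ν θ.τ9.M (gOfRecord₁₀ F N θ.toStage9Params p) p.K k s.init,
      Measurable (Function.uncurry (noExpIntegrandAt F N (FluctV N) p.K k (WtOfRecord₁₂ F N θ p)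
        (tkBranchOfRecord F N (FluctV N) θ.ν θ.τ9.M _ p.K (WtOfRecord₁₂ F N θ p) s.init S k
          (fun ω => sect2Operand F N (FluctV N) p.K (settingOfRecord₁₂ F N θ p) (θ.Rz p.K) s t Ek U (S, fun j => (ω j).2) (fun j => (ω j).1))))))
    (hC : ∀ S ∈ admSOfRecord F θ.ν θ.τ9.M (gOfRecord₁₀ F N θ.toStage9Params p) p.K k s.init, ∀ V' U₀,
      |noExpIntegrandAt F N (FluctV N) p.K k (WtOfRecord₁₂ F N θ p)
        (tkBranchOfRecord F N (FluctV N) θ.ν θ.τ9.M _ p.K (WtOfRecord₁₂ F N θ p) s.init S k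
          (fun ω => sect2Operand F N (FluctV N) p.K (settingOfRecord₁₂ F N θ p) (θ.Rz p.K) s t Ek U (S, fun j => (ω j).2) (fun j => (ω j).1)))
        V' U₀| ≤ C) :
    sect2Slot F N (FluctV N) p.K (settingOfRecord₁₂ F N θ p) (θ.Rz p.K) (WtOfRecord₁₂ F N θ p) s t Ek U =ᵐ[fieldMeasure (F.P p.K) (k + 1) (SU N)]
      fun V' => ∑ S ∈ admSOfRecord F θ.ν θ.τ9.M (gOfRecord₁₀ F N θ.toStage9Params p) p.K k s.init,
        transportOfRecord F N p.K k (noExpIntegrandAt F N (FluctV N) p.K k (WtOfRecord₁₂ F N θ p)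
          (tkBranchOfRecord F N (FluctV N) θ.ν θ.τ9.M _ p.K (WtOfRecord₁₂ F N θ p) s.init S k
            (fun ω => sect2Operand F N (FluctV N) p.K (settingOfRecord₁₂ F N θ p) (θ.Rz p.K) s t Ek U (S, fun j => (ω j).2) (fun j => (ω j).1)))
          V') V' :=
  TkOfRecord_succ_ae_eq_sum_transportOfRecord_of_Omega_empty θ.ν θ.τ9.M _ p.K (WtOfRecord₁₂ F N θ p) hk s hΩ _ hm hC

/-- **THE (S1ᵀ)_k CLAUSE AT A NO-EXPANSION `s′`, GUARD-FREE**: if `TLaw₁₂ θ p k` holds, its witness satisfies at `s′` with `Ω_{k+1}(s′) = ∅` «`slotT_{k+1}(s′) = 0`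
or `slotT_{k+1}(s′)(V′) = 𝐓_{k+1}(s′) exp A_{k+1}(s′)(V′)` `dV′`-a.e.» — `χ_{k+1}(s′) ≡ 1` there. [cite: Balaban1988Convergent, (3.25) p.270, remark p.262, Theorem p.245] -/
theorem tLaw₁₂_clause_of_Omega_empty {k : ℕ} (hT : TLaw₁₂ F N θ p k)
    (s : SeqOfRecord F θ.ν θ.τ9.M (gOfRecord₁₀ F N θ.toStage9Params p) p.K (k + 1)) (hΩ : s.Ω (k + 1) = ∅) :
    ∃ (t : SeqOfRecord F θ.ν θ.τ9.M (gOfRecord₁₀ F N θ.toStage9Params p) p.K (k + 1) → Sect2.TermValues (F.P p.K) (MatA N) (FluctV N) θ.τ9.M)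
      (Ek : SeqOfRecord F θ.ν θ.τ9.M (gOfRecord₁₀ F N θ.toStage9Params p) p.K (k + 1) → ℝ),
      Sect2.UniversalE t ∧
      (∀ s', Sect2.LawsT (sect2TowerOfRecord F N (FluctV N) p.K (settingOfRecord₁₂ F N θ p) (θ.Rz p.K) s' (t s'))
        (settingOfRecord₁₂ F N θ p).lf (settingOfRecord₁₂ F N θ p).βc k) ∧
      (slotsTOfRecord F N θ.ν θ.τ9 (EOfRecord₁₀ F N θ.toStage9Params) (wOfRecord₉ F N θ.toStage9Params) θ.ppSel p
          (gOfRecord₁₀ F N θ.toStage9Params p) (k + 1) s = 0 ∨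
        ∀ᵐ V' ∂fieldMeasure (F.P p.K) (k + 1) (SU N),
          slotsTOfRecord F N θ.ν θ.τ9 (EOfRecord₁₀ F N θ.toStage9Params) (wOfRecord₉ F N θ.toStage9Params) θ.ppSel p
              (gOfRecord₁₀ F N θ.toStage9Params p) (k + 1) s V' =
            sect2Slot F N (FluctV N) p.K (settingOfRecord₁₂ F N θ p) (θ.Rz p.K) (WtOfRecord₁₂ F N θ p) s (t s) (Ek s)
              (UbgOfRecord₁₂ F N θ p (k + 1) s) V') := by
  obtain ⟨t, Ek, hu, hs⟩ := (tLaw₁₂_iff F N θ p k).mp hT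
  refine ⟨t, Ek, hu, fun s' => (hs s').1, ?_⟩
  rcases (hs s).2 with h0 | hid
  · exact Or.inl h0
  · refine Or.inr ?_
    filter_upwards [hid] with V' hV'
    exact hV' (by rw [chiSeqOfRecord_eq_one_of_Omega_empty F N θ.ν θ.τ9.M _ p.K (k + 1) s hΩ V']; exact one_ne_zero)

/-- **THE LEVEL-(k+1) NO-EXPANSION COHERENCE EQUATION, IN KERNEL** (brick (b) of the N11 residue at its no-expansion histories): at `s′` with `Ω_{k+1}(s′) = ∅`,
`k < K`, given the §2 identity of `ρ_k`'s slot at `init s′` (a witness `(t, E_k)` of `SLaw₁₂ θ p k`, identity branch) and a witness pair `(t′, E_{k+1})` of the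
(S1ᵀ)_k dichotomy at `s′`, under the displayed measurability∕boundedness of the old-branch integrands: EITHER `slotT_{k+1}(s′) ≡ 0` OR, `dV′`-a.e.,
`∫dU δ(ŪV′⁻¹) w(s′)(U,V′)·χ_k(init s′)(U)·𝐓_k(init s′)e^{A_k(init s′)}(U) = Σ_S ∫dU δ(ŪV′⁻¹) ζ0_k(T)·χreg_k(T)·e^{−½quad_k(∅)}·[𝐓_k(init s′,S)e^{A_{k+1}(s′)}_S](U,V′)`
— «old factors agree» is what makes it true in print ((3.24), Thm 2); here both sides are explicit in the tree's objects, the operands `A_k(init s′)` and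
`A_{k+1}(s′)` symbolic. [cite: Balaban1988Convergent, Theorem p.245, (3.1) p.264, (3.24)–(3.25) p.270, (2.18) p.257, (2.21)–(2.23) p.258] -/
theorem tLaw₁₂_coherence_of_Omega_empty {k : ℕ} (hk : k < p.K)
    (s : SeqOfRecord F θ.ν θ.τ9.M (gOfRecord₁₀ F N θ.toStage9Params p) p.K (k + 1)) (hΩ : s.Ω (k + 1) = ∅)
    (t : Sect2.TermValues (F.P p.K) (MatA N) (FluctV N) θ.τ9.M) (Ek : ℝ)
    (hid : ∀ᵐ U₀ ∂fieldMeasure (F.P p.K) k (SU N),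
      chiSeqOfRecord F N θ.ν θ.τ9.M (gOfRecord₁₀ F N θ.toStage9Params p) p.K k s.init U₀ ≠ 0 →
        slotsOfRecord F N θ.ν θ.τ9 (EOfRecord₁₀ F N θ.toStage9Params) (wOfRecord₉ F N θ.toStage9Params) θ.ppSel p
            (gOfRecord₁₀ F N θ.toStage9Params p) k s.init U₀ =
          sect2Slot F N (FluctV N) p.K (settingOfRecord₁₂ F N θ p) (θ.Rz p.K) (WtOfRecord₁₂ F N θ p) s.init t Ek
            (UbgOfRecord₁₂ F N θ p k s.init) U₀)
    (t' : Sect2.TermValues (F.P p.K) (MatA N) (FluctV N) θ.τ9.M) (Ek' : ℝ)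
    (hcl : slotsTOfRecord F N θ.ν θ.τ9 (EOfRecord₁₀ F N θ.toStage9Params) (wOfRecord₉ F N θ.toStage9Params) θ.ppSel p
          (gOfRecord₁₀ F N θ.toStage9Params p) (k + 1) s = 0 ∨
        ∀ᵐ V' ∂fieldMeasure (F.P p.K) (k + 1) (SU N),
          slotsTOfRecord F N θ.ν θ.τ9 (EOfRecord₁₀ F N θ.toStage9Params) (wOfRecord₉ F N θ.toStage9Params) θ.ppSel p
              (gOfRecord₁₀ F N θ.toStage9Params p) (k + 1) s V' =
            sect2Slot F N (FluctV N) p.K (settingOfRecord₁₂ F N θ p) (θ.Rz p.K) (WtOfRecord₁₂ F N θ p) s t' Ek'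
              (UbgOfRecord₁₂ F N θ p (k + 1) s) V')
    {C : ℝ}
    (hm : ∀ S ∈ admSOfRecord F θ.ν θ.τ9.M (gOfRecord₁₀ F N θ.toStage9Params p) p.K k s.init,
      Measurable (Function.uncurry (noExpIntegrandAt F N (FluctV N) p.K k (WtOfRecord₁₂ F N θ p)
        (tkBranchOfRecord F N (FluctV N) θ.ν θ.τ9.M _ p.K (WtOfRecord₁₂ F N θ p) s.init S k
          (fun ω => sect2Operand F N (FluctV N) p.K (settingOfRecord₁₂ F N θ p) (θ.Rz p.K) s t' Ek' (UbgOfRecord₁₂ F N θ p (k + 1) s)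
            (S, fun j => (ω j).2) (fun j => (ω j).1))))))
    (hC : ∀ S ∈ admSOfRecord F θ.ν θ.τ9.M (gOfRecord₁₀ F N θ.toStage9Params p) p.K k s.init, ∀ V' U₀,
      |noExpIntegrandAt F N (FluctV N) p.K k (WtOfRecord₁₂ F N θ p)
        (tkBranchOfRecord F N (FluctV N) θ.ν θ.τ9.M _ p.K (WtOfRecord₁₂ F N θ p) s.init S k
          (fun ω => sect2Operand F N (FluctV N) p.K (settingOfRecord₁₂ F N θ p) (θ.Rz p.K) s t' Ek' (UbgOfRecord₁₂ F N θ p (k + 1) s)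
            (S, fun j => (ω j).2) (fun j => (ω j).1)))
        V' U₀| ≤ C) :
    slotsTOfRecord F N θ.ν θ.τ9 (EOfRecord₁₀ F N θ.toStage9Params) (wOfRecord₉ F N θ.toStage9Params) θ.ppSel p
        (gOfRecord₁₀ F N θ.toStage9Params p) (k + 1) s = 0 ∨
      (fun V' => transportOfRecord F N p.K k (fun U₀ =>
          wOfRecord₉ F N θ.toStage9Params p (gOfRecord₁₀ F N θ.toStage9Params p) k s U₀ V' *
            (chiSeqOfRecord F N θ.ν θ.τ9.M (gOfRecord₁₀ F N θ.toStage9Params p) p.K k s.init U₀ *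
              sect2Slot F N (FluctV N) p.K (settingOfRecord₁₂ F N θ p) (θ.Rz p.K) (WtOfRecord₁₂ F N θ p) s.init t Ek
                (UbgOfRecord₁₂ F N θ p k s.init) U₀)) V')
        =ᵐ[fieldMeasure (F.P p.K) (k + 1) (SU N)]
      fun V' => ∑ S ∈ admSOfRecord F θ.ν θ.τ9.M (gOfRecord₁₀ F N θ.toStage9Params p) p.K k s.init,
        transportOfRecord F N p.K k (noExpIntegrandAt F N (FluctV N) p.K k (WtOfRecord₁₂ F N θ p)
          (tkBranchOfRecord F N (FluctV N) θ.ν θ.τ9.M _ p.K (WtOfRecord₁₂ F N θ p) s.init S k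
            (fun ω => sect2Operand F N (FluctV N) p.K (settingOfRecord₁₂ F N θ p) (θ.Rz p.K) s t' Ek' (UbgOfRecord₁₂ F N θ p (k + 1) s)
              (S, fun j => (ω j).2) (fun j => (ω j).1)))
          V') V' := by
  rcases hcl with h0 | hcl
  · exact Or.inl h0
  · refine Or.inr ?_
    have h1 := transportK_congr_ae_family (avOfRecord_measurable F N p.K k) (avOfRecord_haarAC F N p.K k hk)
      (f := fun V' U₀ => wOfRecord₉ F N θ.toStage9Params p (gOfRecord₁₀ F N θ.toStage9Params p) k s U₀ V' *
        (chiSeqOfRecord F N θ.ν θ.τ9.M (gOfRecord₁₀ F N θ.toStage9Params p) p.K k s.init U₀ *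
          slotsOfRecord F N θ.ν θ.τ9 (EOfRecord₁₀ F N θ.toStage9Params) (wOfRecord₉ F N θ.toStage9Params) θ.ppSel p
            (gOfRecord₁₀ F N θ.toStage9Params p) k s.init U₀))
      (g := fun V' U₀ => wOfRecord₉ F N θ.toStage9Params p (gOfRecord₁₀ F N θ.toStage9Params p) k s U₀ V' *
        (chiSeqOfRecord F N θ.ν θ.τ9.M (gOfRecord₁₀ F N θ.toStage9Params p) p.K k s.init U₀ *
          sect2Slot F N (FluctV N) p.K (settingOfRecord₁₂ F N θ p) (θ.Rz p.K) (WtOfRecord₁₂ F N θ p) s.init t Ek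
            (UbgOfRecord₁₂ F N θ p k s.init) U₀))
      (hid.mono fun U₀ hU V' => by
        by_cases hχ : chiSeqOfRecord F N θ.ν θ.τ9.M (gOfRecord₁₀ F N θ.toStage9Params p) p.K k s.init U₀ = 0
        · simp only [hχ, zero_mul, mul_zero]
        · rw [hU hχ])
    have h2 := sect2Slot_succ_ae_eq_sum_transport_of_Omega_empty θ p hk s hΩ t' Ek' (UbgOfRecord₁₂ F N θ p (k + 1) s) hm hC
    filter_upwards [hcl, h1, h2] with V' e0 e1 e2
    rw [← e2, ← e0, slotsTOfRecord_succ_apply]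
    exact e1.symm

end AtRecord

end Literature.MathematicalPhysics.QuantumFieldTheory.Balaban1983to89.Node00

end
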